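import Literature.Algebra.EuclideanLattices.SmoothingGaussianDeriv
import HarnessLib

/-!
# Poisson formulas for the first two directional moments of `D_{Λ,s,c}` (toward MR07 Lemma 4.2)

Topic `Algebra/EuclideanLattices` (family `pqc`), sequel of `SmoothingGaussianDeriv.lean` (the primal
side); serves the decomposition of Micciancio–Regev 2007, Thm. 5.23
(`Literature.Computability.Cryptography.MicciancioRegev2007_gapCVP'_to_SIS'`) through MR07 Lemma 4.2.
Here: the dual side of the shifted Poisson identity
`∑_{x ∈ L} ρ_s(x - (c + tu)) = K ∑_{y ∈ L*} ρ_{1/s}(y) cos(2π⟪c + tu, y⟫)`, `K = vol(L)⁻¹ sⁿ`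
(`tsum_gaussianFunction_sub_eq`), is differentiated termwise once and twice in `t`, and uniqueness of
derivatives gives the two **moment Poisson formulas** (MR07, proof of Lemma 4.2, eq. (7) with (9) and
(10): `ĝ₁(y) = -i y₁ ρ̂_c(y)`, `ĝ₂(y) = (1/2π - y₁²) ρ̂_c(y)`, here for any direction `u` and parameter
`s`). Everything is PROVED; theorems only.

## Results (full-rank `L` in the `n`-dimensional `V`, `0 < s`, `c u ∈ V`, `K = vol(L)⁻¹ sⁿ`)

* `hasDerivAt_gaussianFunction_mul_cos`, `hasDerivAt_deriv_gaussianFunction_mul_cos`,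
  `hasDerivAt_tsum_gaussianFunction_mul_cos`, `hasDerivAt_tsum_deriv_gaussianFunction_mul_cos` — the dual
  terms `ρ_{1/s}(y) cos(2π⟪c + tu, y⟫)`, their `t`-derivatives and the termwise differentiation of the
  dual series (derivatives dominated by `2π‖u‖‖y‖ρ_{1/s}(y)`, `4π²‖u‖²‖y‖²ρ_{1/s}(y)`).
* `tsum_inner_mul_gaussianFunction_sub_eq` — **first-moment Poisson formula**:
  `∑_{x ∈ L} ⟪x - c, u⟫ ρ_s(x - c) = -s² K ∑_{y ∈ L*} ρ_{1/s}(y) ⟪u, y⟫ sin(2π⟪c, y⟫)`.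
* `tsum_inner_sq_mul_gaussianFunction_sub_eq` — **second-moment Poisson formula**:
  `∑_{x ∈ L} ⟪x - c, u⟫² ρ_s(x - c) - (s²‖u‖²/(2π)) ρ_{s,c}(L) = -s⁴ K ∑_{y ∈ L*} ρ_{1/s}(y) ⟪u, y⟫² cos(2π⟪c, y⟫)`.

## References

* D. Micciancio, O. Regev, *Worst-case to average-case reductions based on Gaussian measures*,
  SIAM J. Comput. 37 (2007) 267–302, Lemma 4.2 and its proof, eqs. (7)–(10) (authors' version
  pp. 13–14).
-/

noncomputable section

open MeasureTheory Module Metric Filter Set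
open scoped Real ENNReal InnerProductSpace Topology

namespace Literature.Algebra.EuclideanLattices

variable {V : Type*} [NormedAddCommGroup V] [InnerProductSpace ℝ V]

/-! ### Termwise calculus: the dual cosine term -/

/-- The phase `t ↦ 2π⟪c + tu, y⟫` is affine with derivative `2π⟪u, y⟫`. [folklore] -/
theorem hasDerivAt_two_pi_inner_add_smul (c u y : V) (t : ℝ) :
    HasDerivAt (fun t : ℝ ↦ 2 * π * ⟪c + t • u, y⟫_ℝ) (2 * π * ⟪u, y⟫_ℝ) t := by
  have hfun : (fun t : ℝ ↦ 2 * π * ⟪c + t • u, y⟫_ℝ) = fun t : ℝ ↦ 2 * π * ⟪c, y⟫_ℝ + t * (2 * π * ⟪u, y⟫_ℝ) := by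
    funext t
    rw [inner_add_left, real_inner_smul_left]
    ring
  rw [hfun]
  simpa using ((hasDerivAt_id t).mul_const (2 * π * ⟪u, y⟫_ℝ)).const_add (2 * π * ⟪c, y⟫_ℝ)

/-- The `t`-derivative of the dual term `ρ_{1/s}(y) cos(2π⟪c + tu, y⟫)` is
`-(ρ_{1/s}(y) (2π⟪u, y⟫) sin(2π⟪c + tu, y⟫))`. [cite: MicciancioRegev2007, Lemma 4.2 (proof, eqs. (9)–(10), p. 14)] -/
theorem hasDerivAt_gaussianFunction_mul_cos (s : ℝ) (c u y : V) (t : ℝ) :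
    HasDerivAt (fun t : ℝ ↦ gaussianFunction s⁻¹ y * Real.cos (2 * π * ⟪c + t • u, y⟫_ℝ))
      (-(gaussianFunction s⁻¹ y * (2 * π * ⟪u, y⟫_ℝ) * Real.sin (2 * π * ⟪c + t • u, y⟫_ℝ))) t := by
  have h := ((hasDerivAt_two_pi_inner_add_smul c u y t).cos).const_mul (gaussianFunction s⁻¹ y)
  refine h.congr_deriv ?_
  ring

/-- The second `t`-derivative of the dual term:
`d/dt [-(ρ_{1/s}(y) (2π⟪u, y⟫) sin(2π⟪c + tu, y⟫))] = -(ρ_{1/s}(y) (2π⟪u, y⟫)² cos(2π⟪c + tu, y⟫))`.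
[cite: MicciancioRegev2007, Lemma 4.2 (proof, eqs. (9)–(10), p. 14)] -/
theorem hasDerivAt_deriv_gaussianFunction_mul_cos (s : ℝ) (c u y : V) (t : ℝ) :
    HasDerivAt (fun t : ℝ ↦ -(gaussianFunction s⁻¹ y * (2 * π * ⟪u, y⟫_ℝ) * Real.sin (2 * π * ⟪c + t • u, y⟫_ℝ)))
      (-(gaussianFunction s⁻¹ y * (2 * π * ⟪u, y⟫_ℝ) ^ 2 * Real.cos (2 * π * ⟪c + t • u, y⟫_ℝ))) t := by
  have h := (((hasDerivAt_two_pi_inner_add_smul c u y t).sin).const_mul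
    (gaussianFunction s⁻¹ y * (2 * π * ⟪u, y⟫_ℝ))).neg
  refine h.congr_deriv ?_
  ring

section Series

variable [FiniteDimensional ℝ V] [MeasurableSpace V] [BorelSpace V]
variable (L : Submodule ℤ V) [DiscreteTopology L] [IsZLattice ℝ L]

omit [MeasurableSpace V] [BorelSpace V] in
/-- **Polynomially weighted dual Gaussian sums converge**: `∑_{y ∈ L*} ‖y‖ᵏ ρ_{1/s}(y) < ∞` for
`k = 0, 1, 2` — packaged as: a function on `L*` bounded by `C ‖y‖ᵏ ρ_{1/s}(y)` (`k ≤ 2`) is summable.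
[folklore] -/
theorem summable_of_le_mul_norm_pow_mul_gaussianFunction {s : ℝ} (hs : 0 < s) {f : dualLattice L → ℝ} {C : ℝ}
    (hC : 0 ≤ C) {k : ℕ} (hk : k ≤ 2) (hf0 : ∀ y, 0 ≤ f y)
    (hf : ∀ y, f y ≤ C * (‖(y : V)‖ ^ k * gaussianFunction s⁻¹ (y : V))) : Summable f := by
  set b : ℝ := (finrank ℝ V : ℝ) + 3 with hb
  have hb0 : (0 : ℝ) ≤ b := by positivity
  set E : ℝ := Real.exp (b ^ 2 / (4 * (π / s⁻¹ ^ 2))) with hE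
  refine summable_of_le_mul_one_add_norm_rpow (dualLattice L) (C := C * E) (b := b - k) (by
    rw [hb]; have : (k : ℝ) ≤ 2 := by exact_mod_cast hk
    linarith) hf0 fun y ↦ (hf y).trans ?_
  have hρ := norm_coe_gaussianFunction_sub_le (inv_pos.2 hs) (0 : V) hb0 (y : V)
  rw [Complex.norm_real, Real.norm_eq_abs, abs_of_pos (gaussianFunction_pos _ _), sub_zero, norm_zero,
    add_zero, Real.one_rpow, mul_one] at hρ
  have hy1 : 0 < 1 + ‖(y : V)‖ := by positivity
  have hpow : ‖(y : V)‖ ^ k ≤ (1 + ‖(y : V)‖) ^ (k : ℝ) := by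
    rw [Real.rpow_natCast]
    exact pow_le_pow_left₀ (norm_nonneg _) (by linarith [norm_nonneg (y : V)]) k
  calc C * (‖(y : V)‖ ^ k * gaussianFunction s⁻¹ (y : V))
      ≤ C * ((1 + ‖(y : V)‖) ^ (k : ℝ) * (E * (1 + ‖(y : V)‖) ^ (-b))) := by
        rw [hE]
        exact mul_le_mul_of_nonneg_left (mul_le_mul hpow hρ (gaussianFunction_pos _ _).le (by positivity)) hC
    _ = C * E * ((1 + ‖(y : V)‖) ^ (k : ℝ) * (1 + ‖(y : V)‖) ^ (-b)) := by ring
    _ = C * E * (1 + ‖(y : V)‖) ^ (-(b - k)) := by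
        rw [← Real.rpow_add hy1]
        congr 2
        ring

omit [MeasurableSpace V] [BorelSpace V] in
/-- **Termwise differentiation of the dual series**: for every `t`,
`d/dt ∑_{y ∈ L*} ρ_{1/s}(y) cos(2π⟪c + tu, y⟫) = -∑_{y ∈ L*} ρ_{1/s}(y) (2π⟪u, y⟫) sin(2π⟪c + tu, y⟫)`
(the derivatives are dominated by `2π‖u‖‖y‖ρ_{1/s}(y)`, summable).
[cite: MicciancioRegev2007, Lemma 4.2 (proof, eqs. (7), (9), pp. 13–14)] -/
theorem hasDerivAt_tsum_gaussianFunction_mul_cos {s : ℝ} (hs : 0 < s) (c u : V) (t : ℝ) :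
    HasDerivAt (fun t : ℝ ↦ ∑' y : dualLattice L, gaussianFunction s⁻¹ (y : V) * Real.cos (2 * π * ⟪c + t • u, (y : V)⟫_ℝ))
      (∑' y : dualLattice L,
        -(gaussianFunction s⁻¹ (y : V) * (2 * π * ⟪u, (y : V)⟫_ℝ) * Real.sin (2 * π * ⟪c + t • u, (y : V)⟫_ℝ))) t := by
  have hsum : Summable fun y : dualLattice L ↦ 2 * π * ‖u‖ * (‖(y : V)‖ ^ 1 * gaussianFunction s⁻¹ (y : V)) :=
    summable_of_le_mul_norm_pow_mul_gaussianFunction L hs (by positivity) (by norm_num)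
      (fun y ↦ mul_nonneg (by positivity) (mul_nonneg (by positivity) (gaussianFunction_pos _ _).le)) fun _ ↦ le_rfl
  refine hasDerivAt_tsum hsum (fun y t ↦ hasDerivAt_gaussianFunction_mul_cos s c u (y : V) t)
    (fun y t ↦ ?_) (y₀ := 0) ?_ t
  · rw [norm_neg, Real.norm_eq_abs, abs_mul, abs_mul, abs_of_pos (gaussianFunction_pos _ _), pow_one]
    have h1 : |2 * π * ⟪u, (y : V)⟫_ℝ| ≤ 2 * π * ‖u‖ * ‖(y : V)‖ :=
      calc |2 * π * ⟪u, (y : V)⟫_ℝ| = 2 * π * |⟪u, (y : V)⟫_ℝ| := by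
            rw [abs_mul, abs_of_pos (by positivity : (0 : ℝ) < 2 * π)]
        _ ≤ 2 * π * (‖u‖ * ‖(y : V)‖) := mul_le_mul_of_nonneg_left (abs_real_inner_le_norm _ _) (by positivity)
        _ = 2 * π * ‖u‖ * ‖(y : V)‖ := by ring
    calc gaussianFunction s⁻¹ (y : V) * |2 * π * ⟪u, (y : V)⟫_ℝ| * |Real.sin (2 * π * ⟪c + t • u, (y : V)⟫_ℝ)|
        ≤ gaussianFunction s⁻¹ (y : V) * (2 * π * ‖u‖ * ‖(y : V)‖) * 1 :=
          mul_le_mul (mul_le_mul_of_nonneg_left h1 (gaussianFunction_pos _ _).le) (Real.abs_sin_le_one _)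
            (abs_nonneg _) (mul_nonneg (gaussianFunction_pos _ _).le (by positivity))
      _ = 2 * π * ‖u‖ * (‖(y : V)‖ * gaussianFunction s⁻¹ (y : V)) := by ring
  · simpa using summable_gaussianFunction_mul_cos (dualLattice L) (inv_ne_zero hs.ne') c

omit [MeasurableSpace V] [BorelSpace V] in
/-- **Termwise differentiation of the derived dual series**: for every `t`,
`d/dt ∑_{y} -(ρ_{1/s}(y)(2π⟪u, y⟫) sin(2π⟪c + tu, y⟫)) = -∑_{y} ρ_{1/s}(y)(2π⟪u, y⟫)² cos(2π⟪c + tu, y⟫)`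
(dominated by `4π²‖u‖²‖y‖²ρ_{1/s}(y)`). [cite: MicciancioRegev2007, Lemma 4.2 (proof, eqs. (7), (10), pp. 13–14)] -/
theorem hasDerivAt_tsum_deriv_gaussianFunction_mul_cos {s : ℝ} (hs : 0 < s) (c u : V) (t : ℝ) :
    HasDerivAt (fun t : ℝ ↦ ∑' y : dualLattice L,
        -(gaussianFunction s⁻¹ (y : V) * (2 * π * ⟪u, (y : V)⟫_ℝ) * Real.sin (2 * π * ⟪c + t • u, (y : V)⟫_ℝ)))
      (∑' y : dualLattice L,
        -(gaussianFunction s⁻¹ (y : V) * (2 * π * ⟪u, (y : V)⟫_ℝ) ^ 2 * Real.cos (2 * π * ⟪c + t • u, (y : V)⟫_ℝ))) t := by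
  have hsum : Summable fun y : dualLattice L ↦ (2 * π * ‖u‖) ^ 2 * (‖(y : V)‖ ^ 2 * gaussianFunction s⁻¹ (y : V)) :=
    summable_of_le_mul_norm_pow_mul_gaussianFunction L hs (by positivity) le_rfl
      (fun y ↦ mul_nonneg (by positivity) (mul_nonneg (by positivity) (gaussianFunction_pos _ _).le)) fun _ ↦ le_rfl
  have h1 : ∀ y : dualLattice L, |2 * π * ⟪u, (y : V)⟫_ℝ| ≤ 2 * π * ‖u‖ * ‖(y : V)‖ := fun y ↦
    calc |2 * π * ⟪u, (y : V)⟫_ℝ| = 2 * π * |⟪u, (y : V)⟫_ℝ| := by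
          rw [abs_mul, abs_of_pos (by positivity : (0 : ℝ) < 2 * π)]
      _ ≤ 2 * π * (‖u‖ * ‖(y : V)‖) := mul_le_mul_of_nonneg_left (abs_real_inner_le_norm _ _) (by positivity)
      _ = 2 * π * ‖u‖ * ‖(y : V)‖ := by ring
  refine hasDerivAt_tsum hsum (fun y t ↦ hasDerivAt_deriv_gaussianFunction_mul_cos s c u (y : V) t)
    (fun y t ↦ ?_) (y₀ := 0) ?_ t
  · rw [norm_neg, Real.norm_eq_abs, abs_mul, abs_mul, abs_of_pos (gaussianFunction_pos _ _)]
    have h2 : |(2 * π * ⟪u, (y : V)⟫_ℝ) ^ 2| ≤ (2 * π * ‖u‖ * ‖(y : V)‖) ^ 2 := by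
      rw [abs_pow]
      exact pow_le_pow_left₀ (abs_nonneg _) (h1 y) 2
    calc gaussianFunction s⁻¹ (y : V) * |(2 * π * ⟪u, (y : V)⟫_ℝ) ^ 2| * |Real.cos (2 * π * ⟪c + t • u, (y : V)⟫_ℝ)|
        ≤ gaussianFunction s⁻¹ (y : V) * (2 * π * ‖u‖ * ‖(y : V)‖) ^ 2 * 1 :=
          mul_le_mul (mul_le_mul_of_nonneg_left h2 (gaussianFunction_pos _ _).le) (Real.abs_cos_le_one _)
            (abs_nonneg _) (mul_nonneg (gaussianFunction_pos _ _).le (by positivity))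
      _ = (2 * π * ‖u‖) ^ 2 * (‖(y : V)‖ ^ 2 * gaussianFunction s⁻¹ (y : V)) := by ring
  · -- summability of the first derivatives at `t = 0`
    refine Summable.of_norm ?_
    refine summable_of_le_mul_norm_pow_mul_gaussianFunction L hs (C := 2 * π * ‖u‖) (k := 1) (by positivity)
      (by norm_num) (fun _ ↦ norm_nonneg _) fun y ↦ ?_
    rw [norm_neg, Real.norm_eq_abs, abs_mul, abs_mul, abs_of_pos (gaussianFunction_pos _ _), pow_one]
    calc gaussianFunction s⁻¹ (y : V) * |2 * π * ⟪u, (y : V)⟫_ℝ| * |Real.sin (2 * π * ⟪c + (0 : ℝ) • u, (y : V)⟫_ℝ)|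
        ≤ gaussianFunction s⁻¹ (y : V) * (2 * π * ‖u‖ * ‖(y : V)‖) * 1 :=
          mul_le_mul (mul_le_mul_of_nonneg_left (h1 y) (gaussianFunction_pos _ _).le) (Real.abs_sin_le_one _)
            (abs_nonneg _) (mul_nonneg (gaussianFunction_pos _ _).le (by positivity))
      _ = 2 * π * ‖u‖ * (‖(y : V)‖ * gaussianFunction s⁻¹ (y : V)) := by ring

/-! ### The two moment Poisson formulas -/

/-- **The derived primal series equals `K` times the derived dual series on `|t| < 1`**:
differentiating `∑_{x ∈ L} ρ_s(x - (c + tu)) = K ∑_{y ∈ L*} ρ_{1/s}(y) cos(2π⟪c + tu, y⟫)` in `t`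
(uniqueness of derivatives). [cite: MicciancioRegev2007, Lemma 4.2 (proof, eq. (7), p. 13)] -/
theorem tsum_deriv_gaussianFunction_sub_add_smul_eq {s : ℝ} (hs : 0 < s) (c u : V) {t : ℝ}
    (ht : t ∈ Ioo (-1 : ℝ) 1) :
    ∑' x : L, 2 * π / s ^ 2 * ⟪(x : V) - (c + t • u), u⟫_ℝ * gaussianFunction s ((x : V) - (c + t • u)) =
      (ZLattice.covolume L)⁻¹ * s ^ finrank ℝ V * ∑' y : dualLattice L,
        -(gaussianFunction s⁻¹ (y : V) * (2 * π * ⟪u, (y : V)⟫_ℝ) * Real.sin (2 * π * ⟪c + t • u, (y : V)⟫_ℝ)) := by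
  have hP := hasDerivAt_tsum_gaussianFunction_sub_add_smul L hs c u ht
  have hD := (hasDerivAt_tsum_gaussianFunction_mul_cos L hs c u t).const_mul
    ((ZLattice.covolume L)⁻¹ * s ^ finrank ℝ V)
  have hfun : (fun t : ℝ ↦ ∑' x : L, gaussianFunction s ((x : V) - (c + t • u))) =
      fun t : ℝ ↦ (ZLattice.covolume L)⁻¹ * s ^ finrank ℝ V *
        ∑' y : dualLattice L, gaussianFunction s⁻¹ (y : V) * Real.cos (2 * π * ⟪c + t • u, (y : V)⟫_ℝ) := by
    funext t
    exact tsum_gaussianFunction_sub_eq L hs (c + t • u)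
  rw [hfun] at hP
  exact hP.unique hD

/-- **First-moment Poisson formula** (Micciancio–Regev 2007, proof of Lemma 4.2, eq. (7) with (9),
for any direction `u` and parameter `s`): with `K = vol(L)⁻¹ sⁿ`,
`∑_{x ∈ L} ⟪x - c, u⟫ ρ_s(x - c) = -s² K ∑_{y ∈ L*} ρ_{1/s}(y) ⟪u, y⟫ sin(2π⟪c, y⟫)`.
[cite: MicciancioRegev2007, Lemma 4.2 (proof, eqs. (7), (9), pp. 13–14)] -/
theorem tsum_inner_mul_gaussianFunction_sub_eq {s : ℝ} (hs : 0 < s) (c u : V) :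
    ∑' x : L, ⟪(x : V) - c, u⟫_ℝ * gaussianFunction s ((x : V) - c) =
      -(s ^ 2 * ((ZLattice.covolume L)⁻¹ * s ^ finrank ℝ V) *
        ∑' y : dualLattice L, gaussianFunction s⁻¹ (y : V) * ⟪u, (y : V)⟫_ℝ * Real.sin (2 * π * ⟪c, (y : V)⟫_ℝ)) := by
  have h := tsum_deriv_gaussianFunction_sub_add_smul_eq L hs c u (t := 0) (by simp)
  simp only [zero_smul, add_zero] at h
  -- pull the constants out of both series
  have hl : ∑' x : L, 2 * π / s ^ 2 * ⟪(x : V) - c, u⟫_ℝ * gaussianFunction s ((x : V) - c) =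
      2 * π / s ^ 2 * ∑' x : L, ⟪(x : V) - c, u⟫_ℝ * gaussianFunction s ((x : V) - c) := by
    rw [← tsum_mul_left]; exact tsum_congr fun x ↦ by ring
  have hr : ∑' y : dualLattice L, -(gaussianFunction s⁻¹ (y : V) * (2 * π * ⟪u, (y : V)⟫_ℝ) * Real.sin (2 * π * ⟪c, (y : V)⟫_ℝ)) =
      -(2 * π) * ∑' y : dualLattice L, gaussianFunction s⁻¹ (y : V) * ⟪u, (y : V)⟫_ℝ * Real.sin (2 * π * ⟪c, (y : V)⟫_ℝ) := by
    rw [← tsum_mul_left]; exact tsum_congr fun y ↦ by ring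
  rw [hl, hr] at h
  have hπ : (π : ℝ) ≠ 0 := Real.pi_ne_zero
  have hs0 : s ≠ 0 := hs.ne'
  have key : ∑' x : L, ⟪(x : V) - c, u⟫_ℝ * gaussianFunction s ((x : V) - c) =
      s ^ 2 / (2 * π) * (2 * π / s ^ 2 * ∑' x : L, ⟪(x : V) - c, u⟫_ℝ * gaussianFunction s ((x : V) - c)) := by
    field_simp
  rw [key, h]
  field_simp

omit [MeasurableSpace V] [BorelSpace V] in
/-- `∑_{x ∈ L} ⟪x - c, u⟫² ρ_s(x - c)` converges (polynomial times Gaussian over a lattice). [folklore] -/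
theorem summable_inner_sq_mul_gaussianFunction_sub {s : ℝ} (hs : 0 < s) (c u : V) :
    Summable fun x : L ↦ ⟪(x : V) - c, u⟫_ℝ ^ 2 * gaussianFunction s ((x : V) - c) := by
  set b : ℝ := (finrank ℝ V : ℝ) + 3 with hb
  have hb0 : (0 : ℝ) ≤ b := by positivity
  have h0 : (0 : ℝ) ∈ Ioo (-1 : ℝ) 1 := by simp
  set E : ℝ := Real.exp (b ^ 2 / (4 * (π / s ^ 2))) * (1 + ‖c‖ + ‖u‖) ^ b with hE
  refine summable_of_le_mul_one_add_norm_rpow L (C := ((1 + ‖c‖ + ‖u‖) * ‖u‖) ^ 2 * E) (b := b - 2)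
    (by rw [hb]; linarith) (fun x ↦ mul_nonneg (sq_nonneg _) (gaussianFunction_pos _ _).le) fun x ↦ ?_
  have hρ := gaussianFunction_sub_add_smul_le hs (x : V) c u hb0 h0
  have hv := norm_sub_add_smul_le (x : V) c u h0
  simp only [zero_smul, add_zero] at hρ hv
  have hin : ⟪(x : V) - c, u⟫_ℝ ^ 2 ≤ ((1 + ‖(x : V)‖) * ((1 + ‖c‖ + ‖u‖) * ‖u‖)) ^ 2 := by
    rw [← sq_abs]
    refine pow_le_pow_left₀ (abs_nonneg _) ((abs_real_inner_le_norm _ _).trans ?_) 2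
    rw [← mul_assoc]
    exact mul_le_mul_of_nonneg_right hv (norm_nonneg _)
  have hx1 : 0 < 1 + ‖(x : V)‖ := by positivity
  calc ⟪(x : V) - c, u⟫_ℝ ^ 2 * gaussianFunction s ((x : V) - c)
      ≤ ((1 + ‖(x : V)‖) * ((1 + ‖c‖ + ‖u‖) * ‖u‖)) ^ 2 * (E * (1 + ‖(x : V)‖) ^ (-b)) := by
        rw [hE]; exact mul_le_mul hin hρ (gaussianFunction_pos _ _).le (by positivity)
    _ = ((1 + ‖c‖ + ‖u‖) * ‖u‖) ^ 2 * E * ((1 + ‖(x : V)‖) ^ 2 * (1 + ‖(x : V)‖) ^ (-b)) := by ring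
    _ = ((1 + ‖c‖ + ‖u‖) * ‖u‖) ^ 2 * E * (1 + ‖(x : V)‖) ^ (-(b - 2)) := by
        rw [show -(b - 2) = 2 + -b by ring, Real.rpow_add hx1, Real.rpow_two]

/-- **The twice-derived primal series equals `K` times the twice-derived dual series at `t = 0`**:
the derived series agree on `|t| < 1` (`tsum_deriv_gaussianFunction_sub_add_smul_eq`), so their
derivatives at `0` agree. [cite: MicciancioRegev2007, Lemma 4.2 (proof, eq. (7), p. 13)] -/
theorem tsum_deriv_deriv_gaussianFunction_sub_eq {s : ℝ} (hs : 0 < s) (c u : V) :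
    ∑' x : L, ((2 * π / s ^ 2) ^ 2 * ⟪(x : V) - c, u⟫_ℝ ^ 2 - 2 * π / s ^ 2 * ‖u‖ ^ 2) * gaussianFunction s ((x : V) - c) =
      (ZLattice.covolume L)⁻¹ * s ^ finrank ℝ V * ∑' y : dualLattice L,
        -(gaussianFunction s⁻¹ (y : V) * (2 * π * ⟪u, (y : V)⟫_ℝ) ^ 2 * Real.cos (2 * π * ⟪c, (y : V)⟫_ℝ)) := by
  have hP := hasDerivAt_tsum_deriv_gaussianFunction_sub_add_smul L hs c u (t := 0) (by simp)
  have hD := (hasDerivAt_tsum_deriv_gaussianFunction_mul_cos L hs c u 0).const_mul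
    ((ZLattice.covolume L)⁻¹ * s ^ finrank ℝ V)
  have heq : (fun t : ℝ ↦ ∑' x : L, 2 * π / s ^ 2 * ⟪(x : V) - (c + t • u), u⟫_ℝ * gaussianFunction s ((x : V) - (c + t • u)))
      =ᶠ[𝓝 0] fun t : ℝ ↦ (ZLattice.covolume L)⁻¹ * s ^ finrank ℝ V * ∑' y : dualLattice L,
        -(gaussianFunction s⁻¹ (y : V) * (2 * π * ⟪u, (y : V)⟫_ℝ) * Real.sin (2 * π * ⟪c + t • u, (y : V)⟫_ℝ)) := by
    filter_upwards [Ioo_mem_nhds (show (-1 : ℝ) < 0 by norm_num) (show (0 : ℝ) < 1 by norm_num)] with t ht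
    exact tsum_deriv_gaussianFunction_sub_add_smul_eq L hs c u ht
  have h := hP.unique (hD.congr_of_eventuallyEq heq)
  simpa only [zero_smul, add_zero] using h

/-- **Second-moment Poisson formula** (Micciancio–Regev 2007, proof of Lemma 4.2, eq. (7) with (10),
for any direction `u` and parameter `s`): with `K = vol(L)⁻¹ sⁿ`,
`∑_{x ∈ L} ⟪x - c, u⟫² ρ_s(x - c) - (s²‖u‖²/(2π)) ρ_{s,c}(L) = -s⁴ K ∑_{y ∈ L*} ρ_{1/s}(y) ⟪u, y⟫² cos(2π⟪c, y⟫)`.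
[cite: MicciancioRegev2007, Lemma 4.2 (proof, eqs. (7), (10), pp. 13–14)] -/
theorem tsum_inner_sq_mul_gaussianFunction_sub_eq {s : ℝ} (hs : 0 < s) (c u : V) :
    ∑' x : L, ⟪(x : V) - c, u⟫_ℝ ^ 2 * gaussianFunction s ((x : V) - c) -
        s ^ 2 * ‖u‖ ^ 2 / (2 * π) * ∑' x : L, gaussianFunction s ((x : V) - c) =
      -(s ^ 4 * ((ZLattice.covolume L)⁻¹ * s ^ finrank ℝ V) *
        ∑' y : dualLattice L, gaussianFunction s⁻¹ (y : V) * ⟪u, (y : V)⟫_ℝ ^ 2 * Real.cos (2 * π * ⟪c, (y : V)⟫_ℝ)) := by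
  have h := tsum_deriv_deriv_gaussianFunction_sub_eq L hs c u
  have h1 := (summable_inner_sq_mul_gaussianFunction_sub L hs c u).mul_left ((2 * π / s ^ 2) ^ 2)
  have h2 := (summable_gaussianFunction_sub L hs.ne' c).mul_left (2 * π / s ^ 2 * ‖u‖ ^ 2)
  have hl : ∑' x : L, ((2 * π / s ^ 2) ^ 2 * ⟪(x : V) - c, u⟫_ℝ ^ 2 - 2 * π / s ^ 2 * ‖u‖ ^ 2) *
        gaussianFunction s ((x : V) - c) =
      (2 * π / s ^ 2) ^ 2 * ∑' x : L, ⟪(x : V) - c, u⟫_ℝ ^ 2 * gaussianFunction s ((x : V) - c) -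
        2 * π / s ^ 2 * ‖u‖ ^ 2 * ∑' x : L, gaussianFunction s ((x : V) - c) := by
    rw [← tsum_mul_left, ← tsum_mul_left, ← h1.tsum_sub h2]
    exact tsum_congr fun x ↦ by ring
  have hr : ∑' y : dualLattice L,
        -(gaussianFunction s⁻¹ (y : V) * (2 * π * ⟪u, (y : V)⟫_ℝ) ^ 2 * Real.cos (2 * π * ⟪c, (y : V)⟫_ℝ)) =
      -(2 * π) ^ 2 * ∑' y : dualLattice L,
        gaussianFunction s⁻¹ (y : V) * ⟪u, (y : V)⟫_ℝ ^ 2 * Real.cos (2 * π * ⟪c, (y : V)⟫_ℝ) := by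
    rw [← tsum_mul_left]; exact tsum_congr fun y ↦ by ring
  rw [hl, hr] at h
  have hπ : (π : ℝ) ≠ 0 := Real.pi_ne_zero
  have hs0 : s ≠ 0 := hs.ne'
  have key : ∑' x : L, ⟪(x : V) - c, u⟫_ℝ ^ 2 * gaussianFunction s ((x : V) - c) -
        s ^ 2 * ‖u‖ ^ 2 / (2 * π) * ∑' x : L, gaussianFunction s ((x : V) - c) =
      (s ^ 2 / (2 * π)) ^ 2 * ((2 * π / s ^ 2) ^ 2 * ∑' x : L, ⟪(x : V) - c, u⟫_ℝ ^ 2 * gaussianFunction s ((x : V) - c) -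
        2 * π / s ^ 2 * ‖u‖ ^ 2 * ∑' x : L, gaussianFunction s ((x : V) - c)) := by
    field_simp
  rw [key, h]
  field_simp

end Series

end Literature.Algebra.EuclideanLattices

end
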